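import Summits.Ventures.QEC.CircuitDistance.ETowerAssembly
import HarnessLib

/-!
# LEVER J — the slim `s = 0` node and its SOUNDNESS (R159 (2); CARD-9 / LEVER-J-BENCH; cell `qec`, experiment CDX, seat qec-cdx-idea-1 g4 draft)

`fiberJ` = the landed `fiberK` (ETowerDefs p680896) with ONE change: when the doubling budget `s = (W − |P|) / 2` is `0`, the fibre system
`⊕_{i ∈ x} M(P_i) = h` is solved by a ONE-PASS eliminator `elimB` whose output is checked IN KERNEL by the certificate `certJ` (no second Gauss
pass, no `Piv` record), and all solutions are listed as `x₀ ⊕ spanAll (kernel generators)`.  The `1 ≤ s` branch is LITERALLY `fiberK`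
(crit-1 PORT NOTE N-J2), so its completeness is the landed `fiberK_complete`; `nodeJ` is the landed `nodeK` with `fiberK ↦ fiberJ`, keeping the
support normalisation `P := bitsOf ns 0 (maskOf S)` (N-J1).

PROVED here (std axioms, no `native_decide`, no `sorry`):
* `solve0s_complete` — if `solve0s cs h = some xs` then every solution `x` of `selXor cs x = h` has `x % 2^|cs| ∈ xs` (S1⁰);
* `fiberJ_complete` — the statement of `ETower.fiberK_complete` with `fiberJ` for `fiberK` (S1ᴶ).
Definitional deltas w.r.t. the benched `LeverJ.lean` 76359d5b (semantics equal, kernel cost within noise): (C1) of `certJ` iterates `List.range p` with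
`getD` instead of `zipIdx`; the kernel generators are listed per non-pivot column via `kOfJ` (the `K`-entry with that top bit) instead of `K` itself
(same list up to order); `kerOK` is not needed for soundness and is dropped from the certificate.
Nothing here changes a deployed code.
(LANDING NOTE, typist qec-cdx-type-2 g0: idea-1 g4's `LeverJSound.lean` 9fd2b4d34d41a43e split MECHANICALLY at the 400-line gate limit —
THIS module = the solver + its linear algebra + `solve0s_complete`; `fiberJ_complete` / `goodFibJ_of_all` / `nodeJ_sound` VERBATIM in
`ETowerLeverJSound`. crit-1 g2 S-audit PASS 2026-08-29T02:29:24Z on the unsplit file.)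
-/

namespace Summit.Ventures.QEC.CircuitDistance.ETower

open Summit.Ventures.QEC.Census Summit.Ventures.QEC.Census.Fold

/-! ## The solver -/

/-- reduce `(v, m)` by a list `B = [(t, b, c), …]`: clear bit `t` with `b`, accumulate the column combination `c` (LINEAR in `(v, m)` for ANY `B`). -/
def redB : List (ℕ × ℕ × ℕ) → ℕ → ℕ → ℕ × ℕ
  | [], v, m => (v, m)
  | (t, b, c) :: B, v, m => if v.testBit t then redB B (v ^^^ b) (m ^^^ c) else redB B v m

/-- the coefficient functional of a reduction list: `cfB B v := (redB B v 0).2`. -/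
def cfB (B : List (ℕ × ℕ × ℕ)) (v : ℕ) : ℕ := (redB B v 0).2

/-- insert keeping top bits decreasing (producer side only). -/
def insB : List (ℕ × ℕ × ℕ) → ℕ × ℕ × ℕ → List (ℕ × ℕ × ℕ)
  | [], e => [e]
  | (t, b, c) :: B, e => if t < e.1 then e :: (t, b, c) :: B else (t, b, c) :: insB B e

/-- UNVERIFIED one-pass elimination of the columns `cs` (column `k` ↦ combination bit `2^k`): reduction list `B` and kernel combinations `K`
(each `K`-entry = `2^j ⊕ z_j`, `j` its non-pivot column = its top bit, `z_j` over pivot columns `< j`).  Bugs here can only make `certJ` fail. -/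
def elimB : List ℕ → ℕ → List (ℕ × ℕ × ℕ) → List ℕ → List (ℕ × ℕ × ℕ) × List ℕ
  | [], _, B, K => (B, K)
  | c :: cs, k, B, K =>
    let rm := redB B c (2 ^ k)
    if rm.1 == 0 then elimB cs (k + 1) B (rm.2 :: K) else elimB cs (k + 1) (insB B (Nat.log2 rm.1, rm.1, rm.2)) K

/-- union of the top bits of `K` = the NON-pivot column mask. -/
def topMask (K : List ℕ) : ℕ := K.foldr (fun k a => a ||| 2 ^ Nat.log2 k) 0

/-- the `K`-entry whose top bit is `j` (or `0` if `j` is a pivot column). -/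
def kOfJ (K : List ℕ) (mN j : ℕ) : ℕ := if mN.testBit j then (K.find? fun k => Nat.log2 k == j).getD 0 else 0

/-- kernel generators, one per non-pivot column `j < p` (zeros dropped) — the `Piv.kerGens` shape. -/
def kerGensJ (K : List ℕ) (mN p : ℕ) : List ℕ := ((List.range p).map (kOfJ K mN)).filter fun k => !(k == 0)

/-- THE CERTIFICATE: (C1) every pivot column `i < p` has `cfB B (cs i) = 2^i`; (C2) every `k ∈ K`: `k < 2^p`, `k ⊕ 2^{log2 k}` avoids the
non-pivot mask, and `⊕_{i ∈ k} cs i = 0`. -/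
def certJ (cs : List ℕ) (B : List (ℕ × ℕ × ℕ)) (K : List ℕ) : Bool :=
  let p := cs.length
  let mN := topMask K
  ((List.range p).all fun i => mN.testBit i || (cfB B (cs.getD i 0) == 2 ^ i)) &&
  (K.all fun k => decide (k < 2 ^ p) && ((k ^^^ 2 ^ Nat.log2 k) &&& mN == 0) && (selXorL cs k == 0))

/-- ALL solutions `x ⊆ [p]` (as numerals `< 2^p`) of `⊕_{i ∈ x} cs i = h`, or `none` if the certificate fails:
`x₀ := cfB B h`; if `⊕_{x₀} cs = h` then `x₀ ⊕ spanAll kerGensJ` else no solution exists. -/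
def solve0s (cs : List ℕ) (h : ℕ) : Option (List ℕ) :=
  let BK := elimB cs 0 [] []
  let mN := topMask BK.2
  if certJ cs BK.1 BK.2 then
    some (if selXorL cs (cfB BK.1 h) == h then (spanAll (kerGensJ BK.2 mN cs.length)).map fun k => cfB BK.1 h ^^^ k else [])
  else none

/-- `fiberK` with the slim `s = 0` branch (LEVER J); the `1 ≤ s` branch IS `fiberK`. -/
def fiberJ (G : Geo) (ns : ℕ) (M Mp : ℕ → ℕ) (W : ℕ) (P : List ℕ) : Option (List (List ℕ)) :=
  if 1 ≤ (W - P.length) / 2 then fiberK G ns M Mp W P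
  else
    match solve0s (P.map M) (frhs Mp P) with
    | none => none
    | some xs => some (xs.map fun x => mkWord G P [] x)

/-- the landed `nodeK` with `fiberJ` for `fiberK` (support normalised first, as in `nodeK`). -/
def nodeJ (G : Geo) (ns : ℕ) (M Mp : ℕ → ℕ) (W : ℕ) (k : List ℕ → Bool) (S : List ℕ) : Bool :=
  let P := bitsOf ns 0 (maskOf S)
  match fiberJ G ns M Mp W P with
  | none => false
  | some out => out.all (guardP G P k)

/-! ## Linear algebra of the certificate -/

/-- `redB` is additive (xor) in the vector, jointly with the coefficient word. -/
theorem redB_xor (B : List (ℕ × ℕ × ℕ)) : ∀ v w m n : ℕ,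
    redB B (v ^^^ w) (m ^^^ n) = ((redB B v m).1 ^^^ (redB B w n).1, (redB B v m).2 ^^^ (redB B w n).2) := by
  induction B with
  | nil => intro v w m n; rfl
  | cons e B ih =>
    obtain ⟨t, b, c⟩ := e
    intro v w m n
    simp only [redB, Nat.testBit_xor]
    rcases hv : v.testBit t with _ | _ <;> rcases hw : w.testBit t with _ | _
    · simp only [Bool.xor_false, Bool.false_eq_true, ↓reduceIte]; exact ih v w m n
    · simp only [Bool.false_xor, ↓reduceIte, Bool.false_eq_true]
      rw [show v ^^^ w ^^^ b = v ^^^ (w ^^^ b) from Nat.xor_assoc _ _ _,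
        show m ^^^ n ^^^ c = m ^^^ (n ^^^ c) from Nat.xor_assoc _ _ _]
      exact ih v (w ^^^ b) m (n ^^^ c)
    · simp only [Bool.xor_false, ↓reduceIte, Bool.false_eq_true]
      rw [show v ^^^ w ^^^ b = (v ^^^ b) ^^^ w by rw [Nat.xor_assoc, Nat.xor_comm w b, ← Nat.xor_assoc],
        show m ^^^ n ^^^ c = (m ^^^ c) ^^^ n by rw [Nat.xor_assoc, Nat.xor_comm n c, ← Nat.xor_assoc]]
      exact ih (v ^^^ b) w (m ^^^ c) n
    · simp only [bne_self_eq_false, Bool.false_eq_true, ↓reduceIte]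
      have h1 : v ^^^ w = (v ^^^ b) ^^^ (w ^^^ b) := by
        rw [Nat.xor_assoc, ← Nat.xor_assoc b w b, Nat.xor_comm b w, Nat.xor_assoc w b b, Nat.xor_self, Nat.xor_zero]
      have h2 : m ^^^ n = (m ^^^ c) ^^^ (n ^^^ c) := by
        rw [Nat.xor_assoc, ← Nat.xor_assoc c n c, Nat.xor_comm c n, Nat.xor_assoc n c c, Nat.xor_self, Nat.xor_zero]
      rw [h1, h2]; exact ih (v ^^^ b) (w ^^^ b) (m ^^^ c) (n ^^^ c)

/-- `redB` of the zero vector. -/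
theorem redB_zero (B : List (ℕ × ℕ × ℕ)) : ∀ m, redB B 0 m = (0, m) := by
  induction B with
  | nil => intro m; rfl
  | cons e B ih => obtain ⟨t, b, c⟩ := e; intro m; simp only [redB, Nat.zero_testBit, Bool.false_eq_true, ↓reduceIte]; exact ih m

/-- The coefficient map `cfB` is additive (xor). -/
theorem cfB_xor (B : List (ℕ × ℕ × ℕ)) (v w : ℕ) : cfB B (v ^^^ w) = cfB B v ^^^ cfB B w := by
  unfold cfB; have := redB_xor B v w 0 0; rw [Nat.xor_zero] at this; rw [this]

/-- `cfB` of the zero vector. -/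
theorem cfB_zero (B : List (ℕ × ℕ × ℕ)) : cfB B 0 = 0 := by unfold cfB; rw [redB_zero]

/-- top bits of `K` are recorded in `topMask K`. -/
theorem exists_of_testBit_topMask (K : List ℕ) {j : ℕ} (h : (topMask K).testBit j = true) : ∃ k ∈ K, Nat.log2 k = j := by
  induction K with
  | nil => simp [topMask] at h
  | cons k K ih =>
    simp only [topMask, List.foldr_cons, Nat.testBit_or, Bool.or_eq_true, Nat.testBit_two_pow] at h
    rcases h with h | h
    · obtain ⟨k', hk', hj⟩ := ih h; exact ⟨k', List.mem_cons_of_mem _ hk', hj⟩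
    · exact ⟨k, List.mem_cons_self, by simpa using h⟩

/-- `lin` only reads the coefficient function at the set bits. -/
theorem lin_congr_testBit {g h : ℕ → ℕ} : ∀ (n i0 u : ℕ), (∀ k, k < n → u.testBit k = true → g (i0 + k) = h (i0 + k)) →
    lin g n i0 u = lin h n i0 u := by
  intro n
  induction n with
  | zero => intro i0 u _; rfl
  | succ n ih =>
    intro i0 u hgh
    rw [lin_succ, lin_succ]
    congr 1
    · split
      · rename_i h1
        have := hgh 0 (Nat.succ_pos _) (by rw [Nat.testBit_zero, decide_eq_true_eq]; omega)
        rw [Nat.add_zero] at this; rw [this]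
      · rfl
    · apply ih (i0 + 1) (u / 2)
      intro k hk hb
      rw [show i0 + 1 + k = i0 + (k + 1) by ring]
      exact hgh (k + 1) (by omega) (by rw [Nat.testBit_succ]; exact hb)

/-- `lin` of values avoiding a mask avoids the mask. -/
theorem lin_and_eq_zero {g : ℕ → ℕ} {m : ℕ} (n : ℕ) (hg : ∀ k, k < n → g k &&& m = 0) (u : ℕ) : lin g n 0 u &&& m = 0 := by
  rw [map_lin_of_xor (fun a => a &&& m) (Nat.zero_and m) (fun a b => Nat.and_xor_distrib_right) g n u]
  rw [lin_congr (h := fun _ => 0) (i0 := 0) (fun k hk => by rw [Nat.zero_add]; exact hg k hk), lin_const_zero]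

/-- A clear bit `j` of `m` means `2 ^ j &&& m = 0`. -/
theorem two_pow_and_eq_zero_of_testBit {m j : ℕ} (h : m.testBit j = false) : 2 ^ j &&& m = 0 := by
  apply Nat.eq_of_testBit_eq; intro i
  rw [Nat.testBit_and, Nat.zero_testBit, Nat.testBit_two_pow]
  by_cases hij : j = i
  · subst hij; rw [h]; simp
  · simp [hij]

/-! ## S1⁰ — completeness of `solve0s` -/

/-- **S1⁰.**  If the certificate passes, every solution of the selection system is listed (on its low `p` bits). -/
theorem solve0s_complete {cs : List ℕ} {h : ℕ} {xs : List ℕ} (hsol : solve0s cs h = some xs) {x : ℕ} (hx : selXor cs x = h) :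
    x % 2 ^ cs.length ∈ xs := by
  -- open the solver
  unfold solve0s at hsol
  simp only at hsol
  set B := (elimB cs 0 [] []).1 with hBdef
  set K := (elimB cs 0 [] []).2 with hKdef
  set p := cs.length with hpdef
  set mN := topMask K with hmNdef
  split at hsol
  swap
  · simp at hsol
  rename_i hcert
  simp only [Option.some.injEq] at hsol
  -- read the certificate
  have hC : certJ cs B K = true := hcert
  unfold certJ at hC
  simp only [Bool.and_eq_true, List.all_eq_true, Bool.or_eq_true, beq_iff_eq, decide_eq_true_eq, List.mem_range] at hC
  obtain ⟨hC1, hC2⟩ := hC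
  simp only [← hpdef, ← hmNdef] at hC1 hC2
  -- the kernel generator of column j and the section Z
  let D : ℕ → ℕ := kOfJ K mN
  let Z : ℕ → ℕ := fun j => D j ^^^ 2 ^ j
  have hD : ∀ j, D j = 0 ∨ (D j ∈ K ∧ Nat.log2 (D j) = j ∧ mN.testBit j = true) := by
    intro j
    simp only [D, kOfJ]
    split
    · rename_i hj
      obtain ⟨k, hk, hkj⟩ := exists_of_testBit_topMask K hj
      have hsome : (K.find? fun k => Nat.log2 k == j).isSome := by
        rw [List.find?_isSome]; exact ⟨k, hk, by simpa using hkj⟩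
      obtain ⟨k', hk'⟩ := Option.isSome_iff_exists.1 hsome
      rw [hk', Option.getD_some]
      refine Or.inr ⟨List.mem_of_find?_eq_some hk', ?_, hj⟩
      have := List.find?_some hk'
      simpa using this
    · exact Or.inl rfl
  have hDsel : ∀ j, selXor cs (D j) = 0 := by
    intro j; rcases hD j with h0 | ⟨hm, -, -⟩
    · rw [h0, selXor_zero]
    · have := (hC2 _ hm).2; rwa [selXorL_eq] at this
  have hDlt : ∀ j, j < p → D j < 2 ^ p := by
    intro j hj; rcases hD j with h0 | ⟨hm, -, -⟩
    · rw [h0]; positivity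
    · exact (hC2 _ hm).1.1
  have hZand : ∀ j, j < p → Z j &&& mN = 0 := by
    intro j hj
    show (D j ^^^ 2 ^ j) &&& mN = 0
    rcases hD j with h0 | ⟨hm, hlog, -⟩
    · rw [h0, Nat.zero_xor]
      apply two_pow_and_eq_zero_of_testBit
      -- j is a pivot column: mN.testBit j = false (else D j ∈ K, not 0 … we only need the bit)
      by_contra hb
      rw [Bool.not_eq_false] at hb
      obtain ⟨k, hk, hkj⟩ := exists_of_testBit_topMask K hb
      -- then kOfJ picks an element, contradiction with D j = 0 is not needed: use (C2) on k directly
      -- fallback: D j = 0 came from the `else` branch only when the bit is false; recover it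
      simp only [D, kOfJ, hb, ↓reduceIte] at h0
      have hsome : (K.find? fun k => Nat.log2 k == j).isSome := by
        rw [List.find?_isSome]; exact ⟨k, hk, by simpa using hkj⟩
      obtain ⟨k', hk'⟩ := Option.isSome_iff_exists.1 hsome
      rw [hk', Option.getD_some] at h0
      have hk'K := List.mem_of_find?_eq_some hk'
      have hsel := List.find?_some hk'
      -- k' = 0 but (C2) says k' ⊕ 2^{log2 k'} avoids mN while bit log2 k' = log2 0 = 0 … use hb with j: log2 k' = j and k' = 0 ⇒ j = 0
      subst h0
      have h00 := (hC2 _ hk'K).1.2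
      rw [Nat.zero_xor] at h00
      have hbit : mN.testBit (Nat.log2 0) = false := by
        have := congrArg (fun n => n.testBit (Nat.log2 0)) h00
        simpa only [Nat.testBit_and, Nat.testBit_two_pow_self, Bool.true_and, Nat.zero_testBit] using this
      have hj0 : Nat.log2 (0 : ℕ) = j := by simpa using hsel
      rw [hj0] at hbit
      rw [hbit] at hb
      exact Bool.false_ne_true hb
    · have := (hC2 _ hm).1.2; rwa [hlog] at this
  have hZsel : ∀ j, j < p → selXor cs (Z j) = cs.getD j 0 := by
    intro j hj
    show selXor cs (D j ^^^ 2 ^ j) = cs.getD j 0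
    rw [selXor_xor, hDsel, Nat.zero_xor, selXor, ← hpdef, lin_two_pow _ _ 0 j hj, Nat.zero_add]
  have hZlt : ∀ j, j < p → Z j < 2 ^ p := fun j hj => Nat.xor_lt_two_pow (hDlt j hj) (Nat.pow_lt_pow_right (by norm_num) hj)
  -- (M2): cfB inverts selXor on pivot-supported words
  have hcf : ∀ w, w < 2 ^ p → w &&& mN = 0 → cfB B (selXor cs w) = w := by
    intro w hw hwm
    rw [selXor, ← hpdef, map_lin_of_xor (cfB B) (cfB_zero B) (cfB_xor B)]
    rw [lin_congr_testBit p 0 w (h := fun k => 2 ^ k) (fun k hk hb => by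
      rw [Nat.zero_add]
      rcases hC1 k hk with hm | hc
      · exfalso
        have := congrArg (fun n => n.testBit k) hwm
        simp only [Nat.testBit_and, hb, hm, Bool.and_self, Nat.zero_testBit] at this
        cases this
      · exact hc)]
    rw [lin_pow_self, Nat.mod_eq_of_lt hw]
  -- the section value y and its properties
  set y := lin Z p 0 x with hydef
  have hysel : selXor cs y = selXor cs x := by
    rw [hydef, map_lin_of_xor (selXor cs) (selXor_zero cs) (selXor_xor cs),
      lin_congr (h := fun k => cs.getD k 0) (i0 := 0) (fun k hk => by rw [Nat.zero_add]; exact hZsel k hk), selXor]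
  have hyand : y &&& mN = 0 := lin_and_eq_zero p hZand x
  have hylt : y < 2 ^ p := lin_lt_two_pow Z p p hZlt x
  have hx0 : cfB B h = y := by rw [← hx, ← hysel, hcf y hylt hyand]
  -- the test passes, and x − y is a listed kernel element
  rw [← hsol, hx0, selXorL_eq, hysel, hx, beq_self_eq_true, if_pos rfl, List.mem_map]
  refine ⟨lin D p 0 x, ?_, ?_⟩
  · have hM := lin_getD_mem_spanAll ((List.range p).map D) x
    rw [List.length_map, List.length_range] at hM
    have : lin (fun j => ((List.range p).map D).getD j 0) p 0 x = lin D p 0 x :=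
      lin_congr (i0 := 0) (fun j hj => by
        rw [Nat.zero_add, List.getD_eq_getElem?_getD, List.getElem?_map, List.getElem?_range hj]; rfl) x
    rw [this] at hM
    exact hM
  · have hK : lin D p 0 x = y ^^^ x % 2 ^ p := by
      rw [hydef, ← lin_pow_self, ← lin_xor_fun]
      exact lin_congr (i0 := 0) (fun j _ => by
        show D (0 + j) = (D (0 + j) ^^^ 2 ^ (0 + j)) ^^^ 2 ^ (0 + j)
        rw [Nat.xor_assoc, Nat.xor_self, Nat.xor_zero]) x
    rw [hK, ← Nat.xor_assoc, Nat.xor_self, Nat.zero_xor]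

end Summit.Ventures.QEC.CircuitDistance.ETower
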